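import Literature.NumberTheory.PAdicHodge.BmaxPlusTUnit
import Literature.NumberTheory.PAdicHodge.AinfThetaFrobeniusKernel
import HarnessLib

/-!
# The `φ`-eigenvectors `φ(a) = ξ·φ(c)·a` in `𝔸_inf` form the line `ℤ_p · ([ε] − 1)/ξ`

Topic `Literature/NumberTheory/PAdicHodge`; namespace `Literature.NumberTheory.PAdicHodge`. THEOREMS ONLY (no definition, no named
fact, no instance). In `𝔸_inf(F) = 𝕎(𝒪_{ℂ_F}♭)` let `ω = ξ·c` be Fontaine's generator of `ker θ` (`FontaineOmega.exists_omega_eq_xi_mul`),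
`u = [ε] − 1 = ξ·w` (`w = uDivXi`). The Breuil–Kisin–Fargues module of `ℤ_p(1)` is governed by the `φ`-equation **`φ(a) = ξ·φ(c)·a`**
(note `ξφ(c) = φ(ω)·ξ/φ(ξ)`):

* `frobenius_uDivXi_eq` — **`w = u/ξ` solves it**: `φ(w) = ξφ(c)·w` (from `φ(u) = u·φ(ω)`);
* `exists_nat_lt_and_sub_natCast_mul_uDivXi_mem_span_p` — modulo `p` every solution is an `𝔽_p`-multiple of `w̄` (in the DOMAIN `𝒪♭` the
  equation reads `ā^p = w̄^{p−1}ā`, so `ā/w̄` is a root of `X^p − X`);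
* ★ `exists_eq_zpToAinf_mul_uDivXi_of_frobenius_eq` — **every solution `a ∈ 𝔸_inf` is `λ·w` with `λ ∈ ℤ_p`** (digit extraction + `p`-adic
  limit; `m·w ∈ pᴺ𝔸_inf` forces `pᴺ ∣ m`).

This is the `𝔸_inf`-end of the `t`-divisibility theorem (TDIV) for `(A_max)^{φ=p} ∩ ker θ` (brick B7 of the φ-road of line `kato_lever`,
crux K★ `stmt-BirchSwinnertonDyer-22226`, memo `Cruxes/StarredOptimalManinUnitFiveSeven/Lines/kato-lever-K2-fontaine-lemma-g24.md`): an
eigenvector `x ∈ A_max` with `θ(x) = 0` gives `y = x/((ξ/p)·v) ∈ A_max` with `φ(y) = ι(ξφ(c))·y`, which is pushed into `ι(𝔸_inf)` and lands here.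
Infrastructure only: BSD / K★ are not proved by any of this.

## References
* [FontaineAsterisque223III] J.-M. Fontaine, *Le corps des périodes p-adiques*, Astérisque 223 (1994), Exp. II §1.5, Exp. III §5.1
  (`I^{[1]}𝔸_inf`, the line `ℤ_p([ε] − 1)`).
* [BhattMorrowScholze2019] B. Bhatt, M. Morrow, P. Scholze, *Integral p-adic Hodge theory*, §3 (`𝔸_inf`, `μ = [ε] − 1`, `ξ̃ = φ(ξ)`).
-/

noncomputable section

open WittVector Field ValuativeRel Polynomial Finset

namespace Literature.NumberTheory.PAdicHodge

open Literature.NumberTheory.GaloisRepresentations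
open Literature.NumberTheory.GaloisRepresentations.IsNonarchimedeanLocalField

variable {F : Type} [Field F] [ValuativeRel F] [TopologicalSpace F] [IsNonarchimedeanLocalField F]
  [CharZero F] {p : ℕ} [Fact p.Prime] [Fact (¬ IsUnit (p : integerC F))]
  [IsAdicComplete (Ideal.span {(p : integerC F)}) (integerC F)]

/-! ### `w = u/ξ` is a solution -/

/-- **`φ(w) = ξ·φ(c)·w`** for `w = ([ε] − 1)/ξ` and `ω = ξ·c`: apply `φ` to `ξ·w = u`, use `φ(u) = u·φ(ω) = ξw·φ(ξ)φ(c)` and cancel `φ(ξ) ≠ 0` in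
the domain `𝔸_inf`. [cite: FontaineAsterisque223III, Exp. III §5.1] -/
theorem frobenius_uDivXi_eq {c : Ainf (p := p) F} (hc : omega = xi * c) :
    WittVector.frobenius (uDivXi : Ainf (p := p) F) = xi * WittVector.frobenius c * uDivXi := by
  have h := congrArg WittVector.frobenius (xi_mul_uDivXi (F := F) (p := p))
  rw [map_mul, frobenius_uAinf_eq_mul_frobenius_omega, ← xi_mul_uDivXi, hc, map_mul] at h
  have hφξ : WittVector.frobenius (xi : Ainf (p := p) F) ≠ 0 := fun h0 =>
    xi_ne_zero ((WittVector.frobenius_bijective p (PreTilt (integerC F) p)).injective (by rw [h0, map_zero]))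
  refine mul_left_cancel₀ hφξ ?_
  linear_combination h

/-! ### Reduction modulo `p` -/

/-- **`w̄ = w mod p ≠ 0` in `𝒪♭`** (`p♭ · w̄ = ε − 1 ≠ 0`). [cite: FontaineAsterisque223III, Exp. II §1.5.4] -/
theorem constantCoeff_uDivXi_ne_zero : WittVector.constantCoeff (uDivXi : Ainf (p := p) F) ≠ 0 := by
  intro h
  have h1 := congrArg WittVector.constantCoeff (xi_mul_uDivXi (F := F) (p := p))
  rw [map_mul, h, mul_zero, constantCoeff_uAinf] at h1
  exact eps_sub_one_ne_zero h1.symm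

omit [CharZero F] [IsAdicComplete (Ideal.span {(p : integerC F)}) (integerC F)] in
/-- `X^p − X = ∏_{k ∈ 𝔽_p} (X − k)` in `𝔽_p[X]`. [cite: FontaineAsterisque223III, Exp. III §5.1] -/
private theorem X_pow_sub_X_eq_prod' :
    (X ^ p - X : (ZMod p)[X]) = ∏ a : ZMod p, (X - C a) := by
  have hp1 : 1 < p := (Fact.out : p.Prime).one_lt
  have hmonic : (X ^ p - X : (ZMod p)[X]).Monic :=
    Polynomial.monic_X_pow_sub (by rw [degree_X]; exact_mod_cast hp1)
  have hroots : (X ^ p - X : (ZMod p)[X]).roots = Finset.univ.val := by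
    have h := FiniteField.roots_X_pow_card_sub_X (ZMod p)
    rwa [ZMod.card] at h
  have hcard : Multiset.card (X ^ p - X : (ZMod p)[X]).roots = (X ^ p - X : (ZMod p)[X]).natDegree := by
    rw [hroots, FiniteField.X_pow_card_sub_X_natDegree_eq _ hp1, ← Finset.card_def, Finset.card_univ, ZMod.card]
  rw [← Polynomial.prod_multiset_X_sub_C_of_monic_of_roots_card_eq hmonic hcard, hroots, Finset.prod_eq_multiset_prod]

omit [CharZero F] [IsAdicComplete (Ideal.span {(p : integerC F)}) (integerC F)] in
/-- **In a domain of characteristic `p`: if `ū ≠ 0`, `ū^p = s·ū` and `ā^p = s·ā`, then `ā = k·ū` for some `k < p`** (`ā/ū` is a root of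
`X^p − X = ∏_{k∈𝔽_p}(X − k)` in the fraction field). [cite: FontaineAsterisque223III, Exp. III §5.1] -/
theorem exists_nat_lt_eq_natCast_mul {a u s : PreTilt (integerC F) p} (hu : u ≠ 0) (hup : u ^ p = s * u) (hap : a ^ p = s * a) :
    ∃ k : ℕ, k < p ∧ a = (k : PreTilt (integerC F) p) * u := by
  let K := FractionRing (PreTilt (integerC F) p)
  have hinj : Function.Injective (algebraMap (PreTilt (integerC F) p) K) := IsFractionRing.injective _ _
  have hu' : algebraMap (PreTilt (integerC F) p) K u ≠ 0 := fun h => hu (hinj (by rw [h, map_zero]))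
  set γ : K := algebraMap (PreTilt (integerC F) p) K a / algebraMap (PreTilt (integerC F) p) K u with hγ
  -- `γ^p = γ`
  have hs0 : s ≠ 0 := fun h0 => by
    rw [h0, zero_mul, pow_eq_zero_iff (Fact.out : p.Prime).ne_zero] at hup
    exact hu hup
  have hs0' : algebraMap (PreTilt (integerC F) p) K s ≠ 0 := fun h => hs0 (hinj (by rw [h, map_zero]))
  have hγp : γ ^ p - γ = 0 := by
    rw [hγ, div_pow, ← map_pow, ← map_pow, hap, hup, map_mul, map_mul, mul_div_mul_left _ _ hs0', sub_self]
  -- the roots of `X^p − X` are the elements of `𝔽_p`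
  let ι : ZMod p →+* K := (algebraMap (PreTilt (integerC F) p) K).comp (ZMod.castHom (dvd_refl p) (PreTilt (integerC F) p))
  have h := congrArg (fun q : (ZMod p)[X] => (q.map ι).eval γ) (X_pow_sub_X_eq_prod' (p := p))
  simp only [Polynomial.map_sub, Polynomial.map_pow, map_X, eval_sub, eval_pow, eval_X, Polynomial.map_prod, map_C,
    eval_prod, eval_C, hγp] at h
  obtain ⟨k, -, hk⟩ := Finset.prod_eq_zero_iff.1 h.symm
  refine ⟨k.val, k.val_lt, hinj ?_⟩
  rw [sub_eq_zero] at hk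
  rw [map_mul, map_natCast, ← div_eq_iff hu', ← hγ, hk]
  change (algebraMap (PreTilt (integerC F) p) K) (ZMod.castHom (dvd_refl p) (PreTilt (integerC F) p) k) = _
  rw [ZMod.castHom_apply, ZMod.cast_eq_val, map_natCast]

/-- **Digit extraction**: if `φ(a) = ξφ(c)·a` then `a = k·w + p·a'` with `k < p` and `φ(a') = ξφ(c)·a'`.
[cite: FontaineAsterisque223III, Exp. III §5.1] -/
theorem exists_eq_natCast_mul_uDivXi_add_p_mul {c : Ainf (p := p) F} (hc : omega = xi * c) {a : Ainf (p := p) F}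
    (ha : WittVector.frobenius a = xi * WittVector.frobenius c * a) :
    ∃ (k : ℕ) (a' : Ainf (p := p) F), k < p ∧ a = (k : Ainf (p := p) F) * uDivXi + (p : Ainf (p := p) F) * a' ∧
      WittVector.frobenius a' = xi * WittVector.frobenius c * a' := by
  -- reduce modulo `p`
  have hw := frobenius_uDivXi_eq hc
  have hred : ∀ {b : Ainf (p := p) F}, WittVector.frobenius b = xi * WittVector.frobenius c * b →
      (WittVector.constantCoeff b) ^ p = (pFlat * (WittVector.constantCoeff c) ^ p) * WittVector.constantCoeff b := by
    intro b hb
    have h := congrArg WittVector.constantCoeff hb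
    rw [map_mul, map_mul, constantCoeff_xi, WittVector.constantCoeff_apply, WittVector.coeff_frobenius_charP,
      WittVector.constantCoeff_apply, WittVector.coeff_frobenius_charP] at h
    exact h
  obtain ⟨k, hk, hka⟩ := exists_nat_lt_eq_natCast_mul constantCoeff_uDivXi_ne_zero (hred hw) (hred ha)
  have h1 : WittVector.constantCoeff (a - (k : Ainf (p := p) F) * uDivXi) = 0 := by
    rw [map_sub, map_mul, map_natCast, hka, sub_self]
  have h2 : a - (k : Ainf (p := p) F) * uDivXi ∈ Ideal.span {(p : Ainf (p := p) F)} :=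
    (WittVector.mem_span_p_iff_coeff_zero_eq_zero _).2 h1
  rw [Ideal.mem_span_singleton] at h2
  obtain ⟨a', ha'⟩ := h2
  refine ⟨k, a', hk, by rw [← ha', add_sub_cancel], ?_⟩
  -- the quotient is again a solution (`𝔸_inf` is `p`-torsion free)
  have h3 : (p : Ainf (p := p) F) * (WittVector.frobenius a' - xi * WittVector.frobenius c * a') = 0 := by
    have e := congrArg WittVector.frobenius ha'
    rw [map_sub, map_mul, map_natCast, map_mul, map_natCast, ha, hw] at e
    linear_combination -e + (xi * WittVector.frobenius c) * ha'
  exact sub_eq_zero.1 (WittVector.eq_zero_of_p_mul_eq_zero _ (by rw [mul_comm]; exact h3))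

/-- **Approximation modulo `pᴺ`**: if `φ(a) = ξφ(c)·a` then `a = r·w + pᴺ·a'` for some `r ∈ ℕ` and a solution `a'`.
[cite: FontaineAsterisque223III, Exp. III §5.1] -/
theorem exists_eq_natCast_mul_uDivXi_add_pow_mul {c : Ainf (p := p) F} (hc : omega = xi * c) (N : ℕ) :
    ∀ {a : Ainf (p := p) F}, WittVector.frobenius a = xi * WittVector.frobenius c * a →
      ∃ (r : ℕ) (a' : Ainf (p := p) F), a = (r : Ainf (p := p) F) * uDivXi + (p : Ainf (p := p) F) ^ N * a' ∧
        WittVector.frobenius a' = xi * WittVector.frobenius c * a' := by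
  induction N with
  | zero => intro a ha; exact ⟨0, a, by rw [Nat.cast_zero, zero_mul, zero_add, pow_zero, one_mul], ha⟩
  | succ N ih =>
    intro a ha
    obtain ⟨r, a', h, ha'⟩ := ih ha
    obtain ⟨k, a'', -, h', ha''⟩ := exists_eq_natCast_mul_uDivXi_add_p_mul hc ha'
    exact ⟨r + p ^ N * k, a'', by rw [h, h', pow_succ]; push_cast; ring, ha''⟩

/-! ### `m·w ∈ pᴺ𝔸_inf` forces `pᴺ ∣ m` -/

/-- **`pᴺ𝔸_inf·w ∩ ℤ·w = pᴺℤ·w`**: if `m·w ∈ pᴺ𝔸_inf` for an integer `m` then `pᴺ ∣ m` (`w̄ ≠ 0` in the domain `𝒪♭` of characteristic `p`,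
and `𝔸_inf` is `p`-torsion free). [cite: FontaineAsterisque223III, Exp. III §5.1] -/
theorem pow_dvd_of_intCast_mul_uDivXi_mem (N : ℕ) :
    ∀ {m : ℤ}, (m : Ainf (p := p) F) * uDivXi ∈ Ideal.span {(p : Ainf (p := p) F) ^ N} → (p : ℤ) ^ N ∣ m := by
  induction N with
  | zero => intro m _; rw [pow_zero]; exact one_dvd m
  | succ N ih =>
    intro m hm
    -- mod `p`: `m̄ · w̄ = 0` in the domain `𝒪♭`, so `p ∣ m`
    have h1 : (m : Ainf (p := p) F) * uDivXi ∈ Ideal.span {(p : Ainf (p := p) F)} :=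
      Ideal.span_singleton_le_span_singleton.2 (dvd_pow_self _ (Nat.succ_ne_zero N)) hm
    rw [WittVector.mem_span_p_iff_coeff_zero_eq_zero, ← WittVector.constantCoeff_apply, map_mul, map_intCast] at h1
    have h2 : ((m : PreTilt (integerC F) p)) = 0 := (mul_eq_zero.1 h1).resolve_right constantCoeff_uDivXi_ne_zero
    obtain ⟨m', rfl⟩ := (CharP.intCast_eq_zero_iff (PreTilt (integerC F) p) p m).1 h2
    -- cancel `p`
    rw [Ideal.mem_span_singleton] at hm
    obtain ⟨z, hz⟩ := hm
    have h3 : (m' : Ainf (p := p) F) * uDivXi = (p : Ainf (p := p) F) ^ N * z := by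
      have e : ((m' : Ainf (p := p) F) * uDivXi - (p : Ainf (p := p) F) ^ N * z) * (p : Ainf (p := p) F) = 0 := by
        push_cast at hz
        linear_combination hz
      exact sub_eq_zero.1 (WittVector.eq_zero_of_p_mul_eq_zero _ e)
    have h4 := ih (m := m') (by rw [Ideal.mem_span_singleton]; exact ⟨z, h3⟩)
    obtain ⟨j, rfl⟩ := h4
    exact ⟨j, by ring⟩

/-! ### The solutions form the line `ℤ_p · w` -/

/-- ★ **Every `a ∈ 𝔸_inf` with `φ(a) = ξ·φ(c)·a` is `λ·w` for some `λ ∈ ℤ_p`** (`w = ([ε] − 1)/ξ`, `ω = ξ·c`): the approximations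
`a ≡ r_N·w (mod pᴺ)` have `p`-adically Cauchy digits `r_N` (by `pow_dvd_of_intCast_mul_uDivXi_mem`), converging to `λ ∈ ℤ_p`, and
`a − λ·w ∈ ⋂ pᴺ𝔸_inf = 0`. [cite: FontaineAsterisque223III, Exp. III §5.1] -/
theorem exists_eq_zpToAinf_mul_uDivXi_of_frobenius_eq {c : Ainf (p := p) F} (hc : omega = xi * c) {a : Ainf (p := p) F}
    (ha : WittVector.frobenius a = xi * WittVector.frobenius c * a) :
    ∃ lam : ℤ_[p], a = zpToAinf lam * uDivXi := by
  choose r a' hra' _ using fun N => exists_eq_natCast_mul_uDivXi_add_pow_mul (F := F) (p := p) hc N ha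
  -- the digits are `p`-adically Cauchy
  have hdvd : ∀ N, (p : ℤ) ^ N ∣ ((r (N + 1) : ℤ) - r N) := by
    intro N
    refine pow_dvd_of_intCast_mul_uDivXi_mem (F := F) (p := p) N ?_
    rw [Ideal.mem_span_singleton]
    refine ⟨a' N - (p : Ainf (p := p) F) * a' (N + 1), ?_⟩
    have h1 := hra' N
    have h2 := hra' (N + 1)
    rw [pow_succ] at h2
    push_cast
    linear_combination h1 - h2
  have hcauchy : ∀ {m n : ℕ}, m ≤ n →
      (r m : ℤ_[p]) ≡ r n [SMOD (Ideal.span {(p : ℤ_[p])} ^ m • ⊤ : Submodule ℤ_[p] ℤ_[p])] := by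
    intro m n hmn
    rw [smul_eq_mul, Ideal.mul_top, SModEq.sub_mem, Ideal.span_singleton_pow, Ideal.mem_span_singleton]
    induction n, hmn using Nat.le_induction with
    | base => rw [sub_self]; exact dvd_zero _
    | succ n hmn ih =>
      have e : (r m : ℤ_[p]) - r (n + 1) = ((r m : ℤ_[p]) - r n) - ((r (n + 1) : ℤ_[p]) - r n) := by ring
      rw [e]
      refine dvd_sub ih ?_
      obtain ⟨j, hj⟩ := hdvd n
      refine Dvd.dvd.trans (pow_dvd_pow _ hmn) ⟨(j : ℤ_[p]), ?_⟩
      have hj' := congrArg (fun z : ℤ => (z : ℤ_[p])) hj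
      push_cast at hj'
      exact hj'
  haveI : IsAdicComplete (Ideal.span {(p : ℤ_[p])}) ℤ_[p] := by
    rw [← PadicInt.maximalIdeal_eq_span_p]; infer_instance
  obtain ⟨lam, hlam⟩ := IsPrecomplete.prec (IsAdicComplete.toIsPrecomplete (I := Ideal.span {(p : ℤ_[p])}))
    (f := fun n => (r n : ℤ_[p])) hcauchy
  refine ⟨lam, ?_⟩
  -- `a − λ w ∈ pᴺ` for every `N`
  have hmem : ∀ N, a - zpToAinf lam * uDivXi ∈ Ideal.span {(p : Ainf (p := p) F) ^ N} := by
    intro N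
    have hN := hlam N
    rw [smul_eq_mul, Ideal.mul_top, SModEq.sub_mem, Ideal.span_singleton_pow, Ideal.mem_span_singleton] at hN
    obtain ⟨e, he⟩ := hN
    have e1 : a - zpToAinf lam * uDivXi = (p : Ainf (p := p) F) ^ N * a' N + zpToAinf ((r N : ℤ_[p]) - lam) * uDivXi := by
      rw [map_sub, map_natCast, hra' N]; ring
    rw [e1, he, map_mul, map_pow, map_natCast]
    exact add_mem (Ideal.mul_mem_right _ _ (Ideal.mem_span_singleton_self _))
      (Ideal.mul_mem_right _ _ (Ideal.mul_mem_right _ _ (Ideal.mem_span_singleton_self _)))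
  have hzero : a - zpToAinf lam * uDivXi = 0 := by
    refine IsHausdorff.haus' (I := Ideal.span {(p : Ainf (p := p) F)}) _ fun N => ?_
    rw [smul_eq_mul, Ideal.mul_top, Ideal.span_singleton_pow, SModEq.zero]
    exact hmem N
  exact (sub_eq_zero.1 hzero)

end Literature.NumberTheory.PAdicHodge

end
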